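import Summits.CriticalPhenomena.PercolationContinuityZ3.Theorems.Transplant.KNCellsBoxProdZ2ChainT
import Summits.CriticalPhenomena.PercolationContinuityZ3.Theorems.Transplant.KNCellsBoxProdZ2ChainTA
import Summits.CriticalPhenomena.PercolationContinuityZ3.Theorems.Transplant.KNCells2ChainSchedBound
import HarnessLib

/-!
# Design (D): the PLANAR ROOM of the tube chains in exactly the shape of p3-g2's kit clause (`BoxProdZ2ConcKits.hkits_tube`, hypothesis
# `hroom`) — for every level `j ≤ j₁` of step `i` and every `v` of the level box `Icc (lo i - j) (hi i + j)`, a scale `ℓ ∈ [ℓ₀, ℓ₁]` with the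
# square `(box 2 ℓ).image (· + v)` inside the planar region of the step and a quarter-face `(orthantFace a τ ℓ).image (· + v)` inside the next
# planar core (= the planar true target `Tpl`)

builds on p205010 (kernel theorem, internal audit signed; external expert review pending) — nothing in this file uses p205010.
Lane `prim-bschramm`, seat `prim-bschramm-p2` (instance assembly A2); helper file (`--supports stmt-CriticalPhenomena-4575`).  Pure `Site 2` geometry.

* `ChainPlanar.Adv.core_route_le` — the straight-run routes with the scale bound `ℓ ≤ 2q + s₁ + R'`;
* **`TubeChainData.room`** (`ℓ₁ := 6t`; levels `j ≤ j₁ ≤ Rlev`, `Rlev + 1 ≤ R'`, `100 R' ≤ t`, `R' + ℓ₀ ≤ t`, steps `i ≤ 86`);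
* **`TubeAdvData.room`** (`ℓ₁ := 2q + s₁ + R'` as a natural number bound `ℓ ≤ ℓ₁` for any `ℓ₁` with `2q + s₁ + R' ≤ ℓ₁`; steps `k ≤ nA`).
The squares are `shiftF v F = F.image (· + v)` of KNCells2ChainPlanar, definitionally p3-g2's form.
[cite: KozmaNitzan2024, §4 Lemma 11 (pp. 22–23), Lemma 12 (pp. 23–25)]
-/

noncomputable section

namespace Summit.CriticalPhenomena.PercolationContinuityZ3.Theorems

namespace Transplant

open Literature.Probability.Percolation Literature.Probability.LatticeModels
open Literature.Probability.Percolation.KozmaNitzan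

/-! ## §1 Straight run: bounded route scales -/

namespace ChainPlanar

namespace Adv

variable {q q' s₁ ρ : ℤ} {R' N : ℕ} {ℓ₀ : ℕ} {a : Fin 2} {σ : ℤ} (hσ : σ = 1 ∨ σ = -1) (c : Site 2) (h : AdvOK q q' s₁ ρ R' ℓ₀ N)
include hσ h

/-- **Routes of the straight run with bounded scales**: as `core_route`, with `ℓ ≤ 2q + s₁ + R'`. [cite: KozmaNitzan2024, §4 Lemma 11 (pp. 22–23)] -/
theorem core_route_le {k : ℕ} (hk : k ≤ N) {v : Site 2}
    (hv : v ∈ sBox a σ c (coreα q s₁ k - R') (coreβ q s₁ k + R') (coreW q q' s₁ R' k + R')) :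
    ∃ ℓ : ℕ, ℓ₀ ≤ ℓ ∧ (ℓ : ℤ) ≤ 2 * q + s₁ + R' ∧ shiftF v (box 2 ℓ) ⊆ region q s₁ ρ a σ c k ∧
      ∃ τ : Fin 2 → ℤˣ, shiftF v (orthantFace a τ ℓ) ⊆ core q q' s₁ R' a σ c (k + 1) := by
  obtain ⟨⟨e0α, e0β, e0W⟩, eF⟩ := core_params (q := q) (q' := q') (s₁ := s₁) (R' := R')
  have hq := h.hq; have hq' := h.hq'; have hs := h.hs; have hs2 := h.hs2; have hρ0 := h.hρ0; have hρ := h.hρ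
  have hR0 : (0 : ℤ) ≤ R' := by positivity
  have hN0 : (0 : ℤ) ≤ N := by positivity
  have hNR : (0 : ℤ) ≤ (N : ℤ) * R' := by positivity
  by_cases hk0 : k = 0
  · subst hk0
    obtain ⟨e1α, e1β, e1W⟩ := eF 1 le_rfl
    rw [e0α, e0β, e0W] at hv
    obtain ⟨ℓ, hℓ0, hℓhi, -, hsq, τ, -, hface⟩ := route_start hσ c (q := q) (q' := q') (s := s₁) (w₁ := w₁ q q' s₁ R')
      (ρ := ρ) (R' := R') (ℓ₀ := ℓ₀) hs (by unfold w₁; linarith) (by nlinarith) hρ0 hv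
    refine ⟨ℓ, hℓ0, hℓhi, by rw [region, if_pos rfl]; exact hsq, τ, ?_⟩
    rw [core, e1α, e1β, e1W]
    convert hface using 2 <;> push_cast <;> ring
  · have hk1 : 1 ≤ k := by omega
    obtain ⟨eα, eβ, eW⟩ := eF k hk1
    obtain ⟨eα', eβ', eW'⟩ := eF (k + 1) (by omega)
    have hkR : ((k : ℤ) - 1) * R' ≤ ((N : ℤ) - 1) * R' :=
      mul_le_mul_of_nonneg_right (by linarith [(by exact_mod_cast hk : (k : ℤ) ≤ N)]) hR0
    have hkR0 : 0 ≤ ((k : ℤ) - 1) * R' := mul_nonneg (by linarith [(by exact_mod_cast hk1 : (1 : ℤ) ≤ k)]) hR0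
    rw [eα, eβ, eW] at hv
    obtain ⟨ℓ, hℓ0, hℓhi, -, hsq, τ, -, hface⟩ := route_advance hσ c (L := q + (k : ℤ) * s₁) (s := s₁)
      (w := w₁ q q' s₁ R' + ((k : ℤ) - 1) * R') (ρ := ρ) (R' := R') (ℓ₀ := ℓ₀) hs hs2 (by unfold w₁; linarith)
      (by unfold w₁; nlinarith) hv
    refine ⟨ℓ, hℓ0, by linarith, by rw [region, if_neg hk0]; exact hsq, τ, ?_⟩
    rw [core, eα', eβ', eW']
    convert hface using 2 <;> push_cast <;> ring

end Adv

end ChainPlanar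

/-! ## §2 The room of the tube chains -/

namespace BoxProdZ2

open Literature.Probability.Percolation.KozmaNitzan.Cells (sgOf sgOf_sign)
open ChainPlanar

variable {W : Type}

namespace TubeChainData

/-- **THE PLANAR ROOM OF THE CORRIDOR CHAIN** (p3-g2's `hroom`, `ℓ₁ := 6t`): for `i ≤ 86`, every level `j ≤ j₁` (`j₁ ≤ Rlev`,
`Rlev + 1 ≤ R'`) and every `v ∈ Icc (lo i - j) (hi i + j)` there is `ℓ ∈ [ℓ₀, 6t]` with `(box 2 ℓ).image (· + v) ⊆ pregion i` and a
quarter-face `(orthantFace a τ ℓ).image (· + v) ⊆ pcore (i + 1)`. [cite: KozmaNitzan2024, §4 Lemmas 11–12 (pp. 22–25)] -/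
theorem room (P : TubeChainData W) (hR : 100 * P.R' ≤ P.t) (hRl : P.Rlev + 1 ≤ P.R') (hj : P.j₁ ≤ P.Rlev) {ℓ₀ : ℕ}
    (hℓ : P.R' + ℓ₀ ≤ P.t) {i : ℕ} (hi : i ≤ Sched.nLast) :
    ∀ j, j ≤ P.j₁ → ∀ v ∈ Finset.Icc (P.lo i - ((j : ℕ) : Site 2)) (P.hi i + ((j : ℕ) : Site 2)), ∃ ℓ, ℓ₀ ≤ ℓ ∧ ℓ ≤ 6 * P.t ∧
      (box 2 ℓ).image (fun t => t + v) ⊆ P.pregion i ∧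
      ∃ (a : Fin 2) (τ' : Fin 2 → ℤˣ), (orthantFace a τ' ℓ).image (fun t => t + v) ⊆ P.pcore (i + 1) := by
  intro j hjj v hv
  rw [TubeChainData.lo, TubeChainData.hi, sBox_enlarge _ _ (sgOf_sign P.du)] at hv
  have hjR : (j : ℤ) ≤ P.R' := by exact_mod_cast (hjj.trans hj).trans (by omega : P.Rlev ≤ P.R')
  have hv' : v ∈ sBox P.du.1 (sgOf P.du) (P.C.cen P.x) (Sched.coreα P.t P.R' i - P.R') (Sched.coreβ P.t P.R' i + P.R')
      (Sched.coreW P.t P.R' i + P.R') :=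
    sBox_mono (sgOf_sign P.du) _ (by linarith) (by linarith) (by linarith) hv
  obtain ⟨ℓ, hℓ0, hℓ1, hsq, a, τ, hface⟩ := Sched.core_route_le (sgOf_sign P.du) (P.C.cen P.x) hR hℓ hi hv'
  exact ⟨ℓ, hℓ0, hℓ1, hsq, a, τ, hface⟩

end TubeChainData

namespace TubeAdvData

/-- **THE PLANAR ROOM OF THE STRAIGHT RUN** (p3-g2's `hroom`): for `k ≤ nA`, every level `j ≤ j₁` (`j₁ ≤ Rlev`, `Rlev + 1 ≤ R'`) and every
`v ∈ Icc (alo k - j) (ahi k + j)` there is `ℓ ∈ [ℓ₀, ℓ₁]` (any `ℓ₁ ≥ 2q + s₁ + R'`) with `(box 2 ℓ).image (· + v) ⊆ aregion k` and a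
quarter-face `(orthantFace a τ ℓ).image (· + v) ⊆ acore (k + 1)`. [cite: KozmaNitzan2024, §4 Lemma 11 (pp. 22–23)] -/
theorem room (P : TubeAdvData W) (hsg : P.sg = 1 ∨ P.sg = -1) (hOK : Adv.AdvOK P.q P.q' P.s₁ P.ρ P.R' P.ℓ₀ P.nA)
    (hRl : P.Rlev + 1 ≤ P.R') (hj : P.j₁ ≤ P.Rlev) {ℓ₁ : ℕ} (hℓ₁ : 2 * P.q + P.s₁ + P.R' ≤ ℓ₁) {k : ℕ} (hk : k ≤ P.nA) :
    ∀ j, j ≤ P.j₁ → ∀ v ∈ Finset.Icc (P.alo k - ((j : ℕ) : Site 2)) (P.ahi k + ((j : ℕ) : Site 2)), ∃ ℓ, P.ℓ₀ ≤ ℓ ∧ ℓ ≤ ℓ₁ ∧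
      (box 2 ℓ).image (fun t => t + v) ⊆ P.aregion k ∧
      ∃ (a : Fin 2) (τ' : Fin 2 → ℤˣ), (orthantFace a τ' ℓ).image (fun t => t + v) ⊆ P.acore (k + 1) := by
  intro j hjj v hv
  rw [alo, ahi, sBox_enlarge _ _ hsg] at hv
  have hjR : (j : ℤ) ≤ P.R' := by exact_mod_cast (hjj.trans hj).trans (by omega : P.Rlev ≤ P.R')
  have hv' : v ∈ sBox P.ax P.sg P.c (Adv.coreα P.q P.s₁ k - P.R') (Adv.coreβ P.q P.s₁ k + P.R') (Adv.coreW P.q P.q' P.s₁ P.R' k + P.R') :=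
    sBox_mono hsg _ (by linarith) (by linarith) (by linarith) hv
  obtain ⟨ℓ, hℓ0, hℓ1, hsq, τ, hface⟩ := Adv.core_route_le hsg P.c hOK hk hv'
  have hℓ1' : ℓ ≤ ℓ₁ := by
    have : (ℓ : ℤ) ≤ ℓ₁ := hℓ1.trans hℓ₁
    exact_mod_cast this
  exact ⟨ℓ, hℓ0, hℓ1', hsq, P.ax, τ, hface⟩

end TubeAdvData

end BoxProdZ2

end Transplant

end Summit.CriticalPhenomena.PercolationContinuityZ3.Theorems

end
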